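import Literature.NumberTheory.Automorphic.Liu2021.LemD1Item3AtVSplitOfSeparation
import Literature.NumberTheory.Automorphic.Liu2021.LemD1SplitPlaceOfFacts
import Literature.NumberTheory.GelbartRogawski1991.LocalLineModelTransport
import HarnessLib

/-!
# [Liu2021, Lem. D.1 (3)] «⇒» at a SPLIT place on `localIndexedFamilyAtV` AT THE `e′_a` TRANSPORT — `(μ, χ)`-clauses from the
# facts IV-4c4, IV-3(a), IV-3(b) and Kudla's local injectivity (hypothesis) — THEOREMS ONLY

Topic `NumberTheory/Automorphic/Liu2021`; namespace `Literature.NumberTheory.Automorphic.Liu2021.Def411WeilCarriers`.  KERNEL ONLY: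
theorems, no definition, no named fact, no `sorry`, debt Δ 0.  The instantiation of
`mu_and_chi_eq_of_areIsomorphicRep_split_of_modelTransport` (`LemD1Item3AtVSplitOfSeparation.lean`) at the reindexing
`e := Equiv.prodUnique (Fin 3) (Fin 1)` with the CANONICAL line-model transport of `LocalLineModelTransport.lean` (B-p13):
member `t`'s section is `s_t := lineTransportSection … (a_t) v ((𝓢_t).s v) _` over `ι_{a_t⁻¹ δ}`, `M_t = 1`
(`omega_lineTransportSection_finLocalSplittings` is an EQUALITY of representations), `ω_{s_t}` smooth
(`isSmooth_lineTransportSection`) and `L²`-isometric when `(𝓢_t).omegaLoc v` is (`hL2`), NON-ZERO at a split place by rows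
IV-3(a)(b) (`splitPlace_model_consequences_of_facts`, through `nontrivial_thetaCoinv_of_modelTransport`).

* `mu_and_chi_eq_of_areIsomorphicRep_split_of_facts (h4 : rankOne_theta_twist_rigidity_split)
  (hIV3a : splitPlace_chiCoinv_iso_parabolicIndGL) (hIV3b : parabolicIndGL_detChar_unitary_isIrreducible) … (hE : ¬ IsField E_v)
  (μ') (hL2 : ∀ t, ((𝓢_t).omegaLoc v).IsL2Isometric μ'³) (i j) (hK) (hiso : quot j ≅ quot i) : mu j = mu i ∧ chi j = chi i`,
  where `hK` is Kudla's local injectivity in TRANSPORTED form — «`lineTransportSplitting x s_i = s_j ⇒ μ_{j,v} = μ_{i,v}`» — the one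
  analytic input still a hypothesis (cell item F2 `LocalKudlaSplittingUniqueness`).

Written for the cell `hodgecm-mathlib`, fan A line `a4-liuD3` at `e₁ = Equiv.prodUnique (Fin 3) (Fin 1)`, stub `stub_splitInjective`:
the Summits-side closer instantiates THIS at the face family (`𝓢_t := chiLocalSplittingsD …`, `μ_t := localMu …`,
`hL2 := GRConstruction.isL2Isometric_omegaLoc_congrW_undoubledSplittings_cmFinLocalFamily`, `μ' := borelPlaceMeasure`).
HC_CM is proved only modulo the 7 printed citations (`hDel`, `h21`, `hLiu418`, `h411`, `h413`, `hD3`, `hD1''`) until rung 0 closes;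
this file discharges none of them and no interface fact.

## References
* [Liu2021] Y. Liu, Camb. J. Math. 9 (2021) = arXiv:2102.11518 — App. D Lemma D.1 (3) (l. 5233) and proof, split case (l. 5249–5254).
* [Minguez2008] A. Mínguez, Ann. Sci. ÉNS 41 (2008) — Thm. 1 p. 718.
* [MoeglinVignerasWaldspurger1987] MVW, LNM 1291, Chap. 2 II.1, Chap. 3 I.1–I.3, III.7, IV.
* [Zelevinsky1980] A. V. Zelevinsky, Ann. Sci. ÉNS 13 (1980), Thm. 4.2.
-/

set_option autoImplicit false

noncomputable section

open scoped Matrix Kronecker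
open NumberField IsDedekindDomain
open _root_.MeasureTheory
open Literature.NumberTheory.Automorphic Literature.NumberTheory.Automorphic.UnitaryGroup
open Literature.RepresentationTheory
open Literature.RepresentationTheory.HeisenbergGroup (MpPsi)
open Literature.NumberTheory.GelbartRogawski1991 Literature.NumberTheory.GelbartRogawski1991.UnitaryDualPair
open Literature.NumberTheory.GelbartRogawski1991.UnitaryDualPair.WeilCoinv
open Literature.NumberTheory.GelbartRogawski1991.UnitaryDualPair.LocalSplitting
open Literature.RepresentationTheory.MoeglinVignerasWaldspurger1987

namespace Literature.NumberTheory.Automorphic.Liu2021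

namespace Def411WeilCarriers

variable (F E : Type) [Field F] [NumberField F] [Field E] [NumberField E] [Algebra F E]
variable (c : E ≃ₐ[F] E) (JV : Matrix (Fin 3) (Fin 3) E) {TV : Matrix (Fin 3) (Fin 3) F}
variable [Algebra.IsQuadraticExtension F E] {δ : E} (hcδ : c δ = -δ) (hδ : δ ≠ 0) {d : F} (hd : δ * δ = algebraMap F E d)

/-- **[Liu2021, App. D Lem. D.1 (3)], `(μ, χ)`-CLAUSES (→) AT A SPLIT PLACE on `localIndexedFamilyAtV … v` at the reindexing
`Equiv.prodUnique (Fin 3) (Fin 1)`, FROM THE FACTS** IV-4c4 (`h4`), IV-3(a) (`hIV3a`), IV-3(b) (`hIV3b`) and Kudla's local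
injectivity in transported form (`hK`), every member transported by the canonical `lineTransportSection` of
`LocalLineModelTransport.lean`: if `E_v` is NOT a field, the members' pair-model Weil representations `(𝓢_t).omegaLoc v` are
`L²(μ'³)`-isometric (`hL2`) and «`ω(μ_j, ε_j, χ_j) ≅ ω(μ_i, ε_i, χ_i)`» (`AreIsomorphicRep (quot j) (quot i)`), then
`mu j = mu i ∧ chi j = chi i`.  Proof: `mu_and_chi_eq_of_areIsomorphicRep_split_of_modelTransport` at `s_t := lineTransportSection …`,
`M_t := 1` (`omega_lineTransportSection_finLocalSplittings`), smoothness `isSmooth_lineTransportSection`, unitarity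
`IsL2Isometric.comp`, non-vanishing `splitPlace_model_consequences_of_facts` + `nontrivial_thetaCoinv_of_modelTransport`.
[cite: Liu2021, App. D Lemma D.1 (3) (l. 5233) and proof, split case (l. 5249–5254)] [cite: Minguez2008, Thm. 1 p. 718]
[cite: Zelevinsky1980, Thm. 4.2] [cite: MoeglinVignerasWaldspurger1987, Chap. 3 III.7, IV.4] -/
theorem mu_and_chi_eq_of_areIsomorphicRep_split_of_facts (h4 : rankOne_theta_twist_rigidity_split)
    (hIV3a : splitPlace_chiCoinv_iso_parabolicIndGL) (hIV3b : Zelevinsky1980.parabolicIndGL_detChar_unitary_isIrreducible.{0})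
    (hV : TV.IsSymm) (hVd : IsUnit TV.det) (hJV : JV = TV.map (algebraMap F E))
    {ι : Type} (aOf : ι → Fˣ) (χOf : ι → Chi F E c)
    (𝓢Of : ∀ i, LocalSplitting.FinLocalSplittings F E c 3 hcδ hδ hd (gram F (Equiv.prodUnique (Fin 3) (Fin 1)) TV (TW F (aOf i)))
      (isSymm_gram F (Equiv.prodUnique (Fin 3) (Fin 1)) hV (isSymm_TW F (aOf i)))
      (reindex_kronecker_eq_gram_map F E (Equiv.prodUnique (Fin 3) (Fin 1)) hJV (JW_eq F E (aOf i))))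
    (μOf : ι → ∀ v : HeightOneSpectrum (𝓞 F), (LocalRing E v)ˣ →* ℂˣ) (hμn : ∀ i v x, ‖((μOf i v x : ℂˣ) : ℂ)‖ = 1)
    (hμc : ∀ i v, Continuous fun x => ((μOf i v x : ℂˣ) : ℂ))
    (hμF : ∀ (i : ι) (v : HeightOneSpectrum (𝓞 F)) (t : (v.adicCompletion F)ˣ),
      μOf i v (Units.map (algebraMap (v.adicCompletion F) (LocalRing E v)).toMonoidHom t) = 1 ↔
        ∃ x : (LocalRing E v)ˣ, (x : LocalRing E v) * conjLocal E c v x = algebraMap (v.adicCompletion F) (LocalRing E v) t)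
    (v : HeightOneSpectrum (𝓞 F)) (hE : ¬ IsField (LocalRing E v))
    [MeasurableSpace (v.adicCompletion F)] [BorelSpace (v.adicCompletion F)]
    (μ' : Measure (v.adicCompletion F)) [μ'.IsAddHaarMeasure]
    (hL2 : ∀ t, ((𝓢Of t).omegaLoc v).IsL2Isometric (Measure.pi fun _ : Fin 3 => μ')) (i j : ι)
    (hK : (∃ (x : (LocalRing E v)ˣ) (hx : algebraMap E (LocalRing E v) (algebraMap F E (↑(aOf j)⁻¹ : F) * δ) =
        (x : LocalRing E v) * conjLocal E c v x * algebraMap E (LocalRing E v) (algebraMap F E (↑(aOf i)⁻¹ : F) * δ)),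
        lineTransportSplitting E v c 3 (conj_lineDelta hcδ (aOf i)) (lineDelta_ne_zero hδ (aOf i)) (lineDelta_mul_self hd (aOf i))
          (conj_lineDelta hcδ (aOf j)) (lineDelta_ne_zero hδ (aOf j)) (lineDelta_mul_self hd (aOf j)) x TV hV hVd hx
          (lineTransportSection F E c 3 hcδ hδ hd TV hV JV hJV (aOf i) v ((𝓢Of i).s v) ((𝓢Of i).proj_s v)) =
        lineTransportSection F E c 3 hcδ hδ hd TV hV JV hJV (aOf j) v ((𝓢Of j).s v) ((𝓢Of j).proj_s v)) →
      μOf j v = μOf i v)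
    (hiso : AreIsomorphicRep
      ((localIndexedFamilyAtV F E c 3 (Equiv.prodUnique (Fin 3) (Fin 1)) JV hcδ hδ hd hV hVd hJV (le_refl 3) aOf χOf 𝓢Of μOf
        hμn hμc hμF v).quot j)
      ((localIndexedFamilyAtV F E c 3 (Equiv.prodUnique (Fin 3) (Fin 1)) JV hcδ hδ hd hV hVd hJV (le_refl 3) aOf χOf 𝓢Of μOf
        hμn hμc hμF v).quot i)) :
    (localIndexedFamilyAtV F E c 3 (Equiv.prodUnique (Fin 3) (Fin 1)) JV hcδ hδ hd hV hVd hJV (le_refl 3) aOf χOf 𝓢Of μOf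
          hμn hμc hμF v).mu j =
        (localIndexedFamilyAtV F E c 3 (Equiv.prodUnique (Fin 3) (Fin 1)) JV hcδ hδ hd hV hVd hJV (le_refl 3) aOf χOf 𝓢Of μOf
          hμn hμc hμF v).mu i ∧
      (localIndexedFamilyAtV F E c 3 (Equiv.prodUnique (Fin 3) (Fin 1)) JV hcδ hδ hd hV hVd hJV (le_refl 3) aOf χOf 𝓢Of μOf
          hμn hμc hμF v).chi j =
        (localIndexedFamilyAtV F E c 3 (Equiv.prodUnique (Fin 3) (Fin 1)) JV hcδ hδ hd hV hVd hJV (le_refl 3) aOf χOf 𝓢Of μOf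
          hμn hμc hμF v).chi i := by
  -- the canonical transports: equality of representations `ω_{s_t} = (𝓢_t).omegaLoc v ∘ (k ↦ k ⊗ 1)`
  have H : ∀ t, (MpPsi.toRep (localSchrodinger F 3 TV v)).comp
        (lineTransportSection F E c 3 hcδ hδ hd TV hV JV hJV (aOf t) v ((𝓢Of t).s v) ((𝓢Of t).proj_s v)) =
      (show Representation ℂ (localPi E c 3 JV v) (SchwartzBruhat (Fin 3 → v.adicCompletion F)) from
        ((𝓢Of t).omegaLoc v).comp (localLineInl E c 3 (Equiv.prodUnique (Fin 3) (Fin 1)) JV (JW F E (aOf t)) v)) :=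
    fun t => omega_lineTransportSection_finLocalSplittings F E c 3 hcδ hδ hd TV hV JV hJV (aOf t) v (𝓢Of t)
  have hM : ∀ (t : ι) (g : localPi E c 3 JV v) (Φ : SchwartzBruhat (Fin 3 → v.adicCompletion F)),
      (LinearEquiv.refl ℂ (SchwartzBruhat (Fin 3 → v.adicCompletion F)))
          (((MpPsi.toRep (localSchrodinger F 3 TV v)).comp
            (lineTransportSection F E c 3 hcδ hδ hd TV hV JV hJV (aOf t) v ((𝓢Of t).s v) ((𝓢Of t).proj_s v))) g Φ) =
        (show Representation ℂ (localPi E c 3 JV v) (SchwartzBruhat (Fin 3 → v.adicCompletion F)) from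
          ((𝓢Of t).omegaLoc v).comp (localLineInl E c 3 (Equiv.prodUnique (Fin 3) (Fin 1)) JV (JW F E (aOf t)) v)) g
          ((LinearEquiv.refl ℂ (SchwartzBruhat (Fin 3 → v.adicCompletion F))) Φ) := fun t g Φ => by
    rw [LinearEquiv.refl_apply, LinearEquiv.refl_apply, H t]
  -- unitarity of the transported sections
  have hL2' : ∀ t, Representation.IsL2Isometric (Measure.pi fun _ : Fin 3 => μ')
      ((MpPsi.toRep (localSchrodinger F 3 TV v)).comp
        (lineTransportSection F E c 3 hcδ hδ hd TV hV JV hJV (aOf t) v ((𝓢Of t).s v) ((𝓢Of t).proj_s v))) := fun t => by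
    rw [H t]
    exact (hL2 t).comp _
  -- non-vanishing at the split place (rows IV-3(a)(b)) for member `j`, moved to `ω_{s_j}`
  have hbig := (splitPlace_model_consequences_of_facts F E c 3 (Equiv.prodUnique (Fin 3) (Fin 1)) JV hcδ hδ hd hV hVd hJV
    (aOf j) (𝓢Of j) (le_refl 3) (χOf j).1
    (norm_chi_eq_one F E c (Algebra.IsQuadraticExtension.finrank_eq_two F E)
      (UnitaryGroup.algEquiv_ne_one_of_apply_eq_neg F E c hcδ hδ) (χOf j))
    (χOf j).2.1 v hIV3a hIV3b μ' hE (hL2 j)).2.2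
  have hnt := nontrivial_thetaCoinv_of_modelTransport F E c 3 (Equiv.prodUnique (Fin 3) (Fin 1)) JV hcδ hδ hd hV hJV aOf χOf
    𝓢Of v j (lineTransportSection F E c 3 hcδ hδ hd TV hV JV hJV (aOf j) v ((𝓢Of j).s v) ((𝓢Of j).proj_s v))
    (LinearEquiv.refl ℂ _) (hM j) (JW F E (aOf j)) (JW_apply_ne_zero F E (aOf j)) hbig
  exact mu_and_chi_eq_of_areIsomorphicRep_split_of_modelTransport F E c hcδ hδ hd (Equiv.prodUnique (Fin 3) (Fin 1)) JV h4
    hV hVd hJV (le_refl 3) aOf χOf 𝓢Of μOf hμn hμc hμF v hE μ' i j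
    (fun t => algebraMap F E (↑(aOf t)⁻¹ : F) * δ) (fun t => conj_lineDelta hcδ (aOf t)) (fun t => lineDelta_ne_zero hδ (aOf t))
    (fun t => ↑(aOf t)⁻¹ * ↑(aOf t)⁻¹ * d) (fun t => lineDelta_mul_self hd (aOf t))
    (fun t => lineTransportSection F E c 3 hcδ hδ hd TV hV JV hJV (aOf t) v ((𝓢Of t).s v) ((𝓢Of t).proj_s v))
    (fun t g => proj_lineTransportSection F E c 3 hcδ hδ hd TV hV JV hJV (aOf t) v ((𝓢Of t).s v) ((𝓢Of t).proj_s v) g)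
    (fun t => isSmooth_lineTransportSection F E c 3 hcδ hδ hd TV hV JV hJV (aOf t) v ((𝓢Of t).s v) ((𝓢Of t).proj_s v)
      ((𝓢Of t).smooth v))
    hL2' (fun _ => LinearEquiv.refl ℂ _) hM hnt hK hiso

end Def411WeilCarriers

end Literature.NumberTheory.Automorphic.Liu2021

end
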